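import Literature.NumberTheory.EllipticCurves.Kato2004.MainConjectureDescentSkeletonProofs
import HarnessLib

/-!
# Kato 2004, Thm. 14.5 (3) as module theory over `ℤ_p⟦T⟧`: `[H¹(ℤ[1/p],T) : z] = p^m · #H²(ℤ[1/p],T)`,
# `m ≥ 0`, from the divisibility of Thm. 12.5 (4) — with NO `L`-value hypothesis, only the survival
# of the zeta element at the bottom layer (companion of `MainConjectureDescentSkeletonProofs`)

K. Kato, *`p`-adic Hodge theory and values of zeta functions of modular forms*, Astérisque **295**
(2004) [Kato2004Asterisque], Thm. 14.5 (3) (p. 236): "Assume `p ≠ 2` … Then we have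
`#(H²(ℤ[1/p],T)) ≤ [H¹(ℤ[1/p],T) : z]`", proved in §14.14 (p. 243) from (14.14.1)–(14.14.2), Lemma 14.15
and the `Λ`-adic divisibility Thm. 12.5 (4). In that proof the standing `L`-value hypothesis of Thm. 14.5
(`L_{(p)}(f,·) ≠ 0`) serves only to make `(𝐇¹(T)/Z(f,T))_𝔭 = 0` at the height-one primes `𝔭 ∋ a`,
i.e. `(𝐇¹/Z)/T` FINITE — the zeta element's image `z̄ ∈ H¹(ℤ[1/p],T)` is non-torsion. This file proves the
inequality as module theory with THAT as the hypothesis (so that it also serves in analytic rank one,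
where `L(E,1) = 0` but `z̄ ≠ 0` is Perrin-Riou's non-vanishing, and under Conj. 12.10 is automatic —
`Kato2004.natCard_coinvariants_quotient_span_eq_pow_of_conj_12_10`): with the data of
`Kato2004.index_zeta_eq_natCard_coinvariants_of_conj_12_10` (same file's §5) and
`ℓ_𝔮(H2) ≤ ℓ_𝔮(H/Λz)` at every height-one `𝔮`,
**`[A : Λ·ι z̄] = p^{e(H/Λz) − e(H2)} · #(H2/TH2)`** (`Kato2004.exists_index_zeta_eq_pow_mul_natCard_coinvariants_of_lengthAt_le`),
after `Kato2004.eulerExp_le_of_lengthAt_le` (`e` is monotone in the local lengths). Both sides being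
powers of `p` times `#H2[T]`, Kato's "`≤`" and this "`p^m ·`" are the same statement. Theorems only; no
definition, no named fact; nothing about Kato's objects is asserted (cell `bsd-potss`, seat `kmc`;
consumer: the rank-one schema of `Summits/BirchSwinnertonDyer/Rank1Residual/Additive/KatoDescentRankOnePR.lean`).

References: [Kato2004Asterisque] Thm. 12.5 (4) (p. 222), Thm. 14.5 (3) (p. 236), §14.14 and Lemma 14.15
(pp. 243–244).
-/

noncomputable section

open scoped Classical

universe u

namespace Literature.NumberTheory.EllipticCurves.Kato2004

open Literature.NumberTheory.EllipticCurves.IwasawaAlgebra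

variable {p : ℕ} [Fact p.Prime]

section Inequality

/-- Monotonicity of the `Γ`-Euler exponent: `ℓ_𝔮(M) ≤ ℓ_𝔮(N)` at every height-one prime (Thm. 12.5 (4))
gives `e(M) ≤ e(N)` (both finitely generated torsion). [cite: Kato2004Asterisque, Thm. 12.5 (4) (p. 222), Lemma 14.15 (p. 244)] -/
theorem eulerExp_le_of_lengthAt_le {M N : Type u} [AddCommGroup M] [Module (IwasawaAlgebra p) M]
    [AddCommGroup N] [Module (IwasawaAlgebra p) N] [Module.Finite (IwasawaAlgebra p) M]
    [Module.Finite (IwasawaAlgebra p) N] (hM : Module.IsTorsion (IwasawaAlgebra p) M)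
    (hN : Module.IsTorsion (IwasawaAlgebra p) N)
    (h : ∀ 𝔮 : PrimeSpectrum (IwasawaAlgebra p), 𝔮.asIdeal.height = 1 →
      Module.lengthAt (IwasawaAlgebra p) M 𝔮 ≤ Module.lengthAt (IwasawaAlgebra p) N 𝔮) :
    eulerExp p M ≤ eulerExp p N := by
  have hSM := finite_heightOneNeT_inter_support M hM
  have hSN := finite_heightOneNeT_inter_support N hN
  set S : Finset (PrimeSpectrum (IwasawaAlgebra p)) := (hSM.union hSN).toFinset with hS
  have hsubM : heightOneNeT p ∩ Function.support (fun 𝔮 ↦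
      (Module.lengthAt (IwasawaAlgebra p) M 𝔮).toNat * constVal p 𝔮) ⊆ S := by
    intro x hx; rw [hS, Set.Finite.coe_toFinset]; exact Or.inl hx
  have hsubN : heightOneNeT p ∩ Function.support (fun 𝔮 ↦
      (Module.lengthAt (IwasawaAlgebra p) N 𝔮).toNat * constVal p 𝔮) ⊆ S := by
    intro x hx; rw [hS, Set.Finite.coe_toFinset]; exact Or.inr hx
  have hSsub : (S : Set (PrimeSpectrum (IwasawaAlgebra p))) ⊆ heightOneNeT p := by
    intro x hx
    rw [hS, Set.Finite.coe_toFinset] at hx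
    rcases hx with hx | hx <;> exact hx.1
  unfold eulerExp
  rw [finsum_mem_eq_sum_of_subset _ hsubM hSsub, finsum_mem_eq_sum_of_subset _ hsubN hSsub]
  refine Finset.sum_le_sum fun i hi ↦ ?_
  have hi' := hSsub (Finset.mem_coe.mpr hi)
  exact Nat.mul_le_mul_right _ (ENat.toNat_le_toNat (h i hi'.1)
    (IwasawaAlgebra.lengthAt_ne_top_of_isTorsion N hN i (le_of_eq hi'.1)))

variable {H H2 A : Type u} [AddCommGroup H] [Module (IwasawaAlgebra p) H]
  [AddCommGroup H2] [Module (IwasawaAlgebra p) H2] [AddCommGroup A] [Module (IwasawaAlgebra p) A]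
  [Module.Finite (IwasawaAlgebra p) H] [NoZeroSMulDivisors (IwasawaAlgebra p) H]
  [Module.Finite (IwasawaAlgebra p) H2]

/-- **Thm. 14.5 (3) as module theory (§14.14 with Lemma 14.15): `[A : Λ·ι z̄] = p^m · #(H2/TH2)` for some
`m ≥ 0`**, from the divisibility of Thm. 12.5 (4) (`ℓ_𝔮(H2) ≤ ℓ_𝔮(H/Λz)` at every height-one `𝔮`), the
data of `index_zeta_eq_natCard_coinvariants_of_conj_12_10`, `H2/TH2` finite, and `(H/Λz)/T` FINITE (the
zeta element survives at the bottom layer — Kato derives this from `L_{(p)}(f,·) ≠ 0` via the dual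
exponential; here it is the hypothesis, so no `L`-value enters): `m = e(H/Λz) − e(H2)`.
[cite: Kato2004Asterisque, Thm. 14.5 (3) (p. 236), §14.14 (14.14.1)–(14.14.2) and Lemma 14.15 (pp. 243–244), Thm. 12.5 (4) (p. 222)] -/
theorem exists_index_zeta_eq_pow_mul_natCard_coinvariants_of_lengthAt_le (z : H) (hz : z ≠ 0)
    (hHZ : Module.IsTorsion (IwasawaAlgebra p) (H ⧸ (IwasawaAlgebra p) ∙ z))
    (hH2 : Module.IsTorsion (IwasawaAlgebra p) H2)
    (hdiv : ∀ 𝔮 : PrimeSpectrum (IwasawaAlgebra p), 𝔮.asIdeal.height = 1 →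
      Module.lengthAt (IwasawaAlgebra p) H2 𝔮 ≤
        Module.lengthAt (IwasawaAlgebra p) (H ⧸ (IwasawaAlgebra p) ∙ z) 𝔮)
    (ι : coinvariants p H →ₗ[IwasawaAlgebra p] A) (π : A →ₗ[IwasawaAlgebra p] invariants p H2)
    (hι : Function.Injective ι) (hπ : Function.Surjective π) (hex : Function.Exact ι π)
    (hfin : Finite (coinvariants p H2))
    (hfinZ : Finite (coinvariants p (H ⧸ (IwasawaAlgebra p) ∙ z))) :
    ∃ m : ℕ, Nat.card (A ⧸ (IwasawaAlgebra p) ∙ ι (Submodule.Quotient.mk z)) =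
      p ^ m * Nat.card (coinvariants p H2) := by
  set Q := H ⧸ (IwasawaAlgebra p) ∙ z with hQ
  obtain ⟨-, hcard2⟩ := natCard_coinvariants_eq_of_finite H2 hH2 hfin
  have hTQ : Module.lengthAt (IwasawaAlgebra p) Q (primeT p) = 0 :=
    lengthAt_primeT_eq_zero_of_finite_coinvariants Q hHZ hfinZ
  obtain ⟨hfinQT, -, hcardQ⟩ := card_coinvariants_of_lengthAt_eq_zero Q hHZ hTQ
  rw [natCard_invariants_quotient_span_eq_one z hz hfinQT, one_mul] at hcardQ
  have hle : eulerExp p H2 ≤ eulerExp p Q := eulerExp_le_of_lengthAt_le hH2 hHZ hdiv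
  refine ⟨eulerExp p Q - eulerExp p H2, ?_⟩
  rw [natCard_quotient_eq_of_exact ι π hι hπ hex, ← natCard_coinvariants_quotient_span z, hcardQ,
    hcard2, mul_comm (p ^ _) _, mul_assoc, ← pow_add, Nat.add_sub_cancel' hle]


/-- **Variant: the survival hypothesis as `[A : Λ·ι z̄] ≠ 0`** (Kato's index is finite, i.e. `z̄` is
non-torsion in `H¹(ℤ[1/p],T)`): then `(H/Λz)/T` is finite — it has the order `[H/TH : Λz̄]`, a factor of
`[A : Λ·ι z̄]` along (14.14.1) — and the previous theorem applies.
[cite: Kato2004Asterisque, Thm. 14.5 (3) (p. 236), §14.14 (p. 243)] -/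
theorem exists_index_zeta_eq_pow_mul_natCard_coinvariants_of_index_ne_zero (z : H) (hz : z ≠ 0)
    (hHZ : Module.IsTorsion (IwasawaAlgebra p) (H ⧸ (IwasawaAlgebra p) ∙ z))
    (hH2 : Module.IsTorsion (IwasawaAlgebra p) H2)
    (hdiv : ∀ 𝔮 : PrimeSpectrum (IwasawaAlgebra p), 𝔮.asIdeal.height = 1 →
      Module.lengthAt (IwasawaAlgebra p) H2 𝔮 ≤
        Module.lengthAt (IwasawaAlgebra p) (H ⧸ (IwasawaAlgebra p) ∙ z) 𝔮)
    (ι : coinvariants p H →ₗ[IwasawaAlgebra p] A) (π : A →ₗ[IwasawaAlgebra p] invariants p H2)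
    (hι : Function.Injective ι) (hπ : Function.Surjective π) (hex : Function.Exact ι π)
    (hfin : Finite (coinvariants p H2))
    (hne : Nat.card (A ⧸ (IwasawaAlgebra p) ∙ ι (Submodule.Quotient.mk z)) ≠ 0) :
    ∃ m : ℕ, Nat.card (A ⧸ (IwasawaAlgebra p) ∙ ι (Submodule.Quotient.mk z)) =
      p ^ m * Nat.card (coinvariants p H2) := by
  have hA : Nat.card (A ⧸ (IwasawaAlgebra p) ∙ ι (Submodule.Quotient.mk z)) =
      Nat.card (invariants p H2) * Nat.card (coinvariants p (H ⧸ (IwasawaAlgebra p) ∙ z)) := by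
    rw [natCard_quotient_eq_of_exact ι π hι hπ hex, ← natCard_coinvariants_quotient_span z]
  have hneZ : Nat.card (coinvariants p (H ⧸ (IwasawaAlgebra p) ∙ z)) ≠ 0 := by
    intro h0
    rw [h0, mul_zero] at hA
    exact hne hA
  exact exists_index_zeta_eq_pow_mul_natCard_coinvariants_of_lengthAt_le z hz hHZ hH2 hdiv ι π hι hπ
    hex hfin (Nat.finite_of_card_ne_zero hneZ)

end Inequality

end Literature.NumberTheory.EllipticCurves.Kato2004

end
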